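import Summits.AnomalousDissipation.AnomalousDissipation.Theorems.MomentParityResolvedDissipationInvariance
import Literature.Analysis.FluidPDE.GalerkinFlow

/-!
# Stub `stub_invarianceAveraging` for line `enstrophy-ui-transfer` (crux `MomentParity.ResolvedDissipation`, stmt-AnomalousDissipation-14284)

An admissible law of the crux is the time average of its own Galerkin evolution (Krylov–Bogoliubov in
reverse). Let `μ` be admissible at `(ν, f, N, R)` (`0 < ν`, `f` smooth zero-mean; a probability law on `H`
carried by level-`N` fields, supported in `‖u‖ ≤ R`, stationary against all polynomial cylindrical band-limited
observables), `Θ u = û|_{freqBall N}` the coefficient map and `φ_t = galerkinCoeffFlow ν f̂|_{freqBall N} t` the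
Galerkin semiflow on coefficient vectors. Then for every window `T > 0` and every measurable `F ≥ 0` on the
coefficient space, `∫ F(Θ u) dμ = T⁻¹ ∫ (∫₀ᵀ F(φ_t(Θ u)) dt) dμ` (`stub_invarianceAveraging`).

How. The measure theory is proved abstractly first, for a continuous `Θ : X → Y` with range in a closed set
`V`, maps `φ_t : Y → Y` jointly continuous on `[0, ∞) × V`, and a law `μ` on `X` whose image `Θ_* μ` is
`φ_t`-invariant for `t ≥ 0`:
* `lintegral_comp_eq_of_map_map_eq` — invariance transports to integrals, `∫ F (φ (Θ u)) dμ = ∫ F (Θ u) dμ`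
  (`lintegral_map'`, `φ` a.e.-measurable for `Θ_* μ`);
* `aemeasurable_of_continuousOn_of_ae_mem` — a map continuous on a measurable set of full measure is
  a.e.-measurable (so is `φ_t` for `Θ_* μ`, `V` being closed and containing every `Θ u`);
* `aemeasurable_uncurry_flow_comp` — `(t, u) ↦ F (φ_t (Θ u))` is a.e.-measurable for `dt|_(0,T) ⊗ μ`
  (joint continuity on `(0, T) × X`, `Measure.restrict_prod_eq_prod_univ`);
* `eq_inv_mul_lintegral_setLIntegral_of_forall_eq` — a time-independent integral is its own window average
  (Tonelli `lintegral_lintegral_swap`, `∫₀ᵀ dt = T`);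
* `lintegral_eq_inv_mul_lintegral_average_of_invariant` — the four combined.
The stub is the specialisation to `X = H`, `Y = (freqBall N → ℂ³)`, `V = galerkinSubspace (freqBall N)`
(closed, finite-dimensional; contains every `Θ u`, `MomentParity.fourierRestrict_coe_mem_galerkinSubspace`),
the jointly continuous Galerkin semiflow (`continuousOn_galerkinCoeffFlow`) and the landed invariance of the
coefficient law of an admissible law (`MomentParityResolvedDissipation.admissible_coeffLaw_invariant`).
-/

noncomputable section

-- `Summit.<Summit>.<Problem>`: single-conjunct summit, the duplicate namespace segment is mandated.
set_option linter.dupNamespace false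

namespace Summit.AnomalousDissipation.AnomalousDissipation.Theorems.MomentParityResolvedDissipation.InvarianceAveraging

open MeasureTheory Filter Topology Set
open scoped ENNReal InnerProductSpace RealInnerProductSpace
open Literature.Analysis.FunctionSpaces Literature.Analysis.FluidPDE
open Summit.AnomalousDissipation.AnomalousDissipation.Theses.MomentParity
open Summit.AnomalousDissipation.AnomalousDissipation.Theorems.CubicParityLoud.Negative (T3 R3 H3 L2T3)
open Summit.AnomalousDissipation.AnomalousDissipation.Theorems.QuarticGate.Negative
  (IsLevel IsBandTest polyGrad IsPolyStationary)

/-! ## Abstract measure theory -/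

/-- **Invariance transports to integrals.** If `Θ_* μ` is invariant under an a.e.-measurable `φ`, then
`∫ F (φ (Θ u)) dμ = ∫ F (Θ u) dμ` for every measurable `F ≥ 0`. [folklore] -/
theorem lintegral_comp_eq_of_map_map_eq {X Y : Type*} [MeasurableSpace X] [MeasurableSpace Y] {μ : Measure X}
    {Θ : X → Y} (hΘ : Measurable Θ) {φ : Y → Y} (hφ : AEMeasurable φ (μ.map Θ))
    (hinv : (μ.map Θ).map φ = μ.map Θ) {F : Y → ℝ≥0∞} (hF : Measurable F) :
    ∫⁻ u, F (φ (Θ u)) ∂μ = ∫⁻ u, F (Θ u) ∂μ :=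
  calc ∫⁻ u, F (φ (Θ u)) ∂μ = ∫⁻ c, F (φ c) ∂(μ.map Θ) :=
        (lintegral_map' (hF.comp_aemeasurable hφ) hΘ.aemeasurable).symm
    _ = ∫⁻ c, F c ∂((μ.map Θ).map φ) := (lintegral_map' hF.aemeasurable hφ).symm
    _ = ∫⁻ c, F c ∂(μ.map Θ) := by rw [hinv]
    _ = ∫⁻ u, F (Θ u) ∂μ := lintegral_map hF hΘ

/-- A map continuous on a measurable set of full measure is a.e.-measurable. [folklore] -/
theorem aemeasurable_of_continuousOn_of_ae_mem {Y Z : Type*} [TopologicalSpace Y] [MeasurableSpace Y]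
    [OpensMeasurableSpace Y] [TopologicalSpace Z] [MeasurableSpace Z] [BorelSpace Z] {ρ : Measure Y}
    {V : Set Y} (hV : MeasurableSet V) (hρ : ∀ᵐ c ∂ρ, c ∈ V) {g : Y → Z} (hg : ContinuousOn g V) :
    AEMeasurable g ρ := by
  rw [← Measure.restrict_eq_self_of_ae_mem hρ]
  exact hg.aemeasurable hV

/-- **Joint a.e.-measurability along a semiflow.** For a continuous `Θ : X → Y` with range in `V`, maps
`φ_t` jointly continuous on `[0, ∞) × V` and a measurable `F`, the function `(t, u) ↦ F (φ_t (Θ u))` is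
a.e.-measurable for `dt|_(0,T) ⊗ μ`. [folklore] -/
theorem aemeasurable_uncurry_flow_comp {X Y Z : Type*} [TopologicalSpace X] [MeasurableSpace X]
    [OpensMeasurableSpace X] [TopologicalSpace Y] [MeasurableSpace Y] [BorelSpace Y] [MeasurableSpace Z]
    {μ : Measure X} [SFinite μ] {Θ : X → Y} (hΘ : Continuous Θ) {V : Set Y} (hΘV : ∀ u, Θ u ∈ V)
    {φ : ℝ → Y → Y} (hφ : ContinuousOn (fun p : ℝ × Y => φ p.1 p.2) (Ici 0 ×ˢ V)) {F : Y → Z}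
    (hF : Measurable F) (T : ℝ) :
    AEMeasurable (Function.uncurry fun t u => F (φ t (Θ u))) ((volume.restrict (Ioo 0 T)).prod μ) := by
  have hψ : Continuous fun p : ℝ × X => (p.1, Θ p.2) := continuous_fst.prodMk (hΘ.comp continuous_snd)
  have hcont : ContinuousOn (fun p : ℝ × X => φ p.1 (Θ p.2)) (Ioo 0 T ×ˢ univ) :=
    hφ.comp hψ.continuousOn fun p hp => ⟨mem_Ici.2 (mem_Ioo.1 hp.1).1.le, hΘV p.2⟩
  rw [Measure.restrict_prod_eq_prod_univ]
  exact hF.comp_aemeasurable (hcont.aemeasurable (measurableSet_Ioo.prod MeasurableSet.univ))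

/-- **A time-independent integral is its own window average** (Tonelli): if `∫ G t dμ = I` for all
`t ∈ (0, T)`, `T > 0`, and `G` is jointly a.e.-measurable, then `I = T⁻¹ ∫ (∫₀ᵀ G t u dt) dμ`. [folklore] -/
theorem eq_inv_mul_lintegral_setLIntegral_of_forall_eq {X : Type*} [MeasurableSpace X] {μ : Measure X}
    [SFinite μ] {G : ℝ → X → ℝ≥0∞} {I : ℝ≥0∞} {T : ℝ} (hT : 0 < T)
    (hG : AEMeasurable (Function.uncurry G) ((volume.restrict (Ioo 0 T)).prod μ))
    (hI : ∀ t ∈ Ioo 0 T, ∫⁻ u, G t u ∂μ = I) :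
    I = (ENNReal.ofReal T)⁻¹ * ∫⁻ u, (∫⁻ t in Ioo 0 T, G t u) ∂μ := by
  have h1 : ∫⁻ t in Ioo 0 T, (∫⁻ u, G t u ∂μ) = ∫⁻ _ in Ioo 0 T, I :=
    setLIntegral_congr_fun measurableSet_Ioo hI
  rw [← lintegral_lintegral_swap hG, h1, setLIntegral_const, Real.volume_Ioo, sub_zero,
    mul_comm I (ENNReal.ofReal T), ← mul_assoc,
    ENNReal.inv_mul_cancel (ENNReal.ofReal_pos.2 hT).ne' ENNReal.ofReal_ne_top, one_mul]

/-- **Krylov–Bogoliubov in reverse (abstract).** If the law `Θ_* μ` of a continuous `Θ : X → Y` with range in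
a closed set `V` is invariant under the maps `φ_t`, `t ≥ 0`, of a family jointly continuous on `[0, ∞) × V`,
then `∫ F (Θ u) dμ = T⁻¹ ∫ (∫₀ᵀ F (φ_t (Θ u)) dt) dμ` for every `T > 0` and every measurable `F ≥ 0`. [folklore] -/
theorem lintegral_eq_inv_mul_lintegral_average_of_invariant {X Y : Type*} [TopologicalSpace X]
    [MeasurableSpace X] [OpensMeasurableSpace X] [TopologicalSpace Y] [MeasurableSpace Y] [BorelSpace Y]
    {μ : Measure X} [SFinite μ] {Θ : X → Y} (hΘ : Continuous Θ) {V : Set Y} (hV : IsClosed V)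
    (hΘV : ∀ u, Θ u ∈ V) {φ : ℝ → Y → Y} (hφ : ContinuousOn (fun p : ℝ × Y => φ p.1 p.2) (Ici 0 ×ˢ V))
    (hinv : ∀ t : ℝ, 0 ≤ t → (μ.map Θ).map (φ t) = μ.map Θ) {T : ℝ} (hT : 0 < T) {F : Y → ℝ≥0∞}
    (hF : Measurable F) :
    ∫⁻ u, F (Θ u) ∂μ = (ENNReal.ofReal T)⁻¹ * ∫⁻ u, (∫⁻ t in Ioo 0 T, F (φ t (Θ u))) ∂μ := by
  refine eq_inv_mul_lintegral_setLIntegral_of_forall_eq hT (aemeasurable_uncurry_flow_comp hΘ hΘV hφ hF T)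
    fun t ht => ?_
  -- time-`t` invariance of the integral: `φ_t` is continuous on the closed full-measure set `V`
  have hφt : ContinuousOn (fun c => φ t c) V :=
    hφ.comp (continuousOn_const.prodMk continuousOn_id) fun c hc => ⟨mem_Ici.2 ht.1.le, hc⟩
  have hae : ∀ᵐ c ∂(μ.map Θ), c ∈ V :=
    (ae_map_iff hΘ.aemeasurable hV.measurableSet).2 (Eventually.of_forall hΘV)
  exact lintegral_comp_eq_of_map_map_eq hΘ.measurable
    (aemeasurable_of_continuousOn_of_ae_mem hV.measurableSet hae hφt) (hinv t ht.1.le) hF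

/-! ## The stub -/

/-- **S3 · `stub_invarianceAveraging` — an admissible law is the time average of its own Galerkin evolution.**
Let `μ` be an admissible law of the crux at `(ν, f, N, R)` (`0 < ν`, `f` smooth zero-mean; probability, level-`N`
carried, supported in `‖u‖ ≤ R`, stationary at every polynomial degree), `Θ u = û|_{freqBall N}` the coefficient
map and `φ_t = galerkinCoeffFlow ν f̂|_{freqBall N} t` the Galerkin semiflow on coefficients. Then for every
window `T > 0` and every measurable `F ≥ 0` on the coefficient space,
`∫ F(Θ u) dμ = T⁻¹ ∫ (∫₀ᵀ F(φ_t(Θ u)) dt) dμ`.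
Proof: `Θ_* μ` is `φ_t`-invariant for every `t ≥ 0` (`MomentParityResolvedDissipation.admissible_coeffLaw_invariant`,
Foias–Manley–Rosa–Temam 2001 Ch. IV App. B.1), `Θ` is continuous with values in the closed phase space
`galerkinSubspace (freqBall N)` (`MomentParity.fourierRestrict_coe_mem_galerkinSubspace`), on which the semiflow is
jointly continuous (`continuousOn_galerkinCoeffFlow`); conclude by
`lintegral_eq_inv_mul_lintegral_average_of_invariant` (invariance of each time-`t` integral, then Tonelli over
the window). [folklore] -/
theorem stub_invarianceAveraging :
    ∀ (ν : ℝ), 0 < ν → ∀ (f : T3 → R3), Torus.IsSmooth f → Torus.HasZeroMean f →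
    ∀ (N : ℕ) (R : ℝ) (μ : Measure H3), IsProbabilityMeasure μ →
      (∀ᵐ u ∂μ, IsLevel N u) → (∀ᵐ u ∂μ, ‖u‖ ≤ R) → (∀ d : ℕ, IsPolyStationary ν f N d μ) →
    ∀ T : ℝ, 0 < T →
    ∀ F : (↥(Torus.freqBall (d := Fin 3) N) → EuclideanSpace ℂ (Fin 3)) → ℝ≥0∞, Measurable F →
      ∫⁻ u, F (fourierRestrict (Torus.freqBall N) (u.1 : T3 → R3)) ∂μ =
        (ENNReal.ofReal T)⁻¹ *
          ∫⁻ u, (∫⁻ t in Set.Ioo 0 T,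
            F (galerkinCoeffFlow ν (fourierRestrict (Torus.freqBall N) f) t
              (fourierRestrict (Torus.freqBall N) (u.1 : T3 → R3)))) ∂μ := by
  intro ν hν f hf hf0 N R μ hP hL hB hS T hT F hF
  -- the force coefficients are real, the coefficient map is continuous
  have hg : Torus.IsRealCoeff (fourierRestrict (Torus.freqBall (d := Fin 3) N) f) :=
    Torus.isRealCoeff_mFourierCoeff hf.integrable
  have hΘ : Continuous fun u : H3 => fourierRestrict (Torus.freqBall N) (u.1 : T3 → R3) :=
    continuous_pi fun k => (Torus.continuous_mFourierCoeff_complexify_coe (k : Fin 3 → ℤ)).comp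
      continuous_subtype_val
  exact lintegral_eq_inv_mul_lintegral_average_of_invariant hΘ
    (galerkinSubspace (Torus.freqBall (d := Fin 3) N)).closed_of_finiteDimensional
    (fun u => MomentParity.fourierRestrict_coe_mem_galerkinSubspace N u)
    (continuousOn_galerkinCoeffFlow hν.le Torus.neg_mem_freqBall_of_mem hg)
    (MomentParityResolvedDissipation.admissible_coeffLaw_invariant ν hν f hf hf0 N R μ hP hL hB hS) hT hF

end Summit.AnomalousDissipation.AnomalousDissipation.Theorems.MomentParityResolvedDissipation.InvarianceAveraging

end
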